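import Literature.Computability.QuantumComplexity.PermanentSearchReplay
import Literature.Computability.Complexity.RatBricks
import HarnessLib

/-!
# Sizes along the replay of the AA13 permanent search, for every factor `g` (including `g = 0`)

Aaronson–Arkhipov, *The computational complexity of linear optics*, Theory of Computing 9 (2013),
proof of Thm. 4.3 (pp. 176–177). `PermanentSearch.lean` proves that along every run of the search the
points stay polynomially sized (`SzInv`, `searchRound_size`: denominators `≤ (3 g P_Y)^t`, points
`≤ t (g (n+1)! + 1)`), for `g ≥ 1` and for runs against an ORACLE. The machine realising the step
function (`PerSearch.randSearchAlg_isPolyTime`, which quantifies over all `g : ℕ`) replays the search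
against an arbitrary TRANSCRIPT (`PermanentSearchReplay.lean`: `replay_searchRound`, `replay_iterM_succ`) and must bound
its registers for `g = 0` too (where `(3 g P_Y)^t = 0` and `SzInv` fails). This file restates the
size invariant uniformly and proves it for the replay functions:

* `USz g m P_Y t st` — `den r ≤ (3 (g+1) P_Y)^t ∧ |r| ≤ t (g (m+1)! + 1)` for the state `st = (t', r, v)`;
* `roundPt_usz` — every grid point `roundPt g m P_Y st i` of a round has denominator
  `≤ den r · P_Y · 3(g+1)` and lies within `g (m+1)! + 1` of `r` (for `g = 0` the grid collapses to
  `r − β'`, Lean reading `2β'/0 = 0`);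
* `searchRound_usz`, `iterM_searchRound_usz` — the invariant propagates through the replay of
  `searchRound` / `iterM searchRound` on every transcript; the new value is an answer of the transcript
  read by `decodeNat` (or the old one), the round counter advances by one per round, the leftover
  transcript is a suffix;
* numeric consequences in powers of two (`usz_den_lt`, `usz_num_lt`, `roundPt_entry_lt`): with
  `P_Y ≤ (m+1)!` and `t ≤ T`, denominators, numerators and the entries of the scaled query matrices
  are `< 2^{poly(m, T, g)}` for the explicit polynomial exponents `denE`, `numE`, `entE`;
* `rounds_le_RB'` — `rounds g m ≤ RB g m` for every `g` (the tree's `rounds_le_RB` assumes `g ≥ 1`).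

## References

* S. Aaronson, A. Arkhipov, *The computational complexity of linear optics*, Theory of Computing 9
  (2013), proof of Thm. 4.3, eqs. (4.9)–(4.19) (p. 177).
-/

namespace Literature.Computability.QuantumComplexity

open _root_.Computability Complexity Complexity.OracleComp Matrix

namespace PerSearch

/-! ### The uniform size invariant -/

/-- **The size invariant of the search state, uniform in `g`**: after `t` rounds at a level of
dimension `m + 1` with minor permanent `P_Y`, the point `r` has denominator `≤ (3 (g+1) P_Y)^t` and
absolute value `≤ t (g (m+1)! + 1)`. [cite: AaronsonArkhipovToC2013, proof of Thm. 4.3, eqs. (4.9)–(4.15) (p. 177)] -/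
def USz (g m PY t : ℕ) (st : ℕ × ℚ × ℕ) : Prop :=
  st.2.1.den ≤ (3 * (g + 1) * PY) ^ t ∧ |st.2.1| ≤ t * (g * ((m + 1).factorial : ℚ) + 1)

/-- The initial state `(0, 0, v₀)` satisfies the invariant at `t = 0`. [folklore] -/
theorem usz_init (g m PY v : ℕ) : USz g m PY 0 (0, 0, v) := by
  simp [USz]

/-- The invariant is monotone in `t` (for `P_Y > 0`). [folklore] -/
theorem USz.mono {g m PY t t' : ℕ} (hPY : 0 < PY) (h : t ≤ t') {st : ℕ × ℚ × ℕ} (hs : USz g m PY t st) : USz g m PY t' st := by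
  obtain ⟨h1, h2⟩ := hs
  have hb : 1 ≤ 3 * (g + 1) * PY := Nat.one_le_iff_ne_zero.2 (by positivity)
  refine ⟨h1.trans (Nat.pow_le_pow_right hb h), h2.trans ?_⟩
  have : (t : ℚ) ≤ t' := by exact_mod_cast h
  have h0 : (0 : ℚ) ≤ g * ((m + 1).factorial : ℚ) + 1 := by positivity
  nlinarith

/-- The denominator of `Z / M` is at most `M` (`M > 0`). [folklore] -/
theorem den_intCast_div_natCast_le (Z : ℤ) {M : ℕ} (hM : 0 < M) : ((Z : ℚ) / (M : ℚ)).den ≤ M := by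
  rw [(Brick.num_den_intCast_div_natCast Z hM).2]
  exact Nat.div_le_self _ _

/-- **Sizes of the grid points of a round**, for every `g`: denominator `≤ den r · P_Y · 3(g+1)` and
distance `≤ g (m+1)! + 1` from `r`. [cite: AaronsonArkhipovToC2013, proof of Thm. 4.3, eq. (4.9) (p. 177)] -/
theorem roundPt_usz (g m : ℕ) {PY : ℕ} (hPY : 0 < PY) (st : ℕ × ℚ × ℕ) {i : ℕ} (hi : i ≤ 3 * g) :
    (roundPt g m PY st i).den ≤ st.2.1.den * PY * (3 * (g + 1)) ∧
      |roundPt g m PY st i - st.2.1| ≤ g * ((m + 1).factorial : ℚ) + 1 := by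
  obtain ⟨t, r, v⟩ := st
  set K := halfK g m v r.den with hK
  set β' : ℚ := ((K : ℕ) : ℚ) / ((r.den : ℚ) * PY) with hβ
  have hpt : roundPt g m PY (t, r, v) i = gridPt r β' (3 * g) i := rfl
  have hw : β' ≤ g * ((m + 1).factorial : ℕ) + 1 := halfwidth_le hPY r.den_pos
  have hw0 : 0 ≤ β' := by rw [hβ]; positivity
  by_cases hg : g = 0
  · subst hg
    have hcollapse : gridPt r β' (3 * 0) i = r - β' := by simp [gridPt]
    -- `r - β' = (a P_Y - K) / (D P_Y)`
    have e : r - β' = ((r.num * PY - (K : ℤ) : ℤ) : ℚ) / ((r.den * PY : ℕ) : ℚ) := by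
      have hD : (r.den : ℚ) ≠ 0 := by exact_mod_cast r.den_pos.ne'
      have hP : (PY : ℚ) ≠ 0 := by exact_mod_cast hPY.ne'
      rw [hβ]
      nth_rw 1 [← Rat.num_div_den r]
      push_cast
      field_simp
    constructor
    · show (roundPt 0 m PY (t, r, v) i).den ≤ r.den * PY * (3 * (0 + 1))
      rw [hpt, hcollapse, e]
      refine (den_intCast_div_natCast_le _ (by positivity)).trans ?_
      nlinarith [r.den_pos, hPY]
    · show |roundPt 0 m PY (t, r, v) i - r| ≤ _
      rw [hpt, hcollapse, show r - β' - r = -β' by ring, abs_neg, abs_of_nonneg hw0]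
      simpa using hw
  · have hL : 0 < 3 * g := by omega
    constructor
    · show (roundPt g m PY (t, r, v) i).den ≤ r.den * PY * (3 * (g + 1))
      rw [hpt, hβ]
      refine (Nat.le_of_dvd (by positivity) (den_gridPt_dvd r K PY (3 * g) i hPY hL)).trans ?_
      exact Nat.mul_le_mul_left _ (by omega)
    · show |roundPt g m PY (t, r, v) i - r| ≤ _
      rw [hpt]
      exact (abs_gridPt_sub_le hw0 hL hi).trans hw

/-- An element of a `zipWith` comes from a pair of entries at the same index. [folklore] -/
theorem exists_of_mem_zipWith {α β γ : Type} {f : α → β → γ} {l : List α} {l' : List β} {c : γ}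
    (h : c ∈ List.zipWith f l l') : ∃ (j : ℕ) (hj : j < l.length) (hj' : j < l'.length), c = f (l[j]) (l'[j]) := by
  obtain ⟨j, hj, rfl⟩ := List.mem_iff_getElem.1 h
  rw [List.length_zipWith] at hj
  exact ⟨j, by omega, by omega, by rw [List.getElem_zipWith]⟩

/-- **One round keeps the sizes, on every transcript** (`P_Y > 0`): if the replay of `searchRound`
finishes, the new state satisfies the invariant at `t + 1`, its counter is the old one plus one, its
value is the old value or an answer of the transcript read by `decodeNat`, and the leftover transcript
is a suffix. [cite: AaronsonArkhipovToC2013, proof of Thm. 4.3, eqs. (4.9)–(4.15) (p. 177)] -/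
theorem searchRound_usz {g m PY t : ℕ} (hPY : 0 < PY) (mk : Maker) (lvl : ℕ) (X : Matrix (Fin (m + 1)) (Fin (m + 1)) ℤ)
    {st : ℕ × ℚ × ℕ} (h : USz g m PY t st) {as as' : List (List Bool)} {st' : ℕ × ℚ × ℕ}
    (hr : replay (searchRound mk g lvl X PY st) as = Sum.inr (st', as')) :
    USz g m PY (t + 1) st' ∧ st'.1 = st.1 + 1 ∧ (st'.2.2 = st.2.2 ∨ ∃ a ∈ as, st'.2.2 = decodeNat a) ∧ as' <:+ as := by
  rw [replay_searchRound] at hr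
  by_cases hv : st.2.2 = 0
  · rw [if_pos hv] at hr
    simp only [Sum.inr.injEq, Prod.mk.injEq] at hr
    obtain ⟨rfl, rfl⟩ := hr
    exact ⟨USz.mono hPY (Nat.le_succ t) h, rfl, Or.inl rfl, List.suffix_refl _⟩
  · rw [if_neg hv] at hr
    by_cases hl : 3 * g + 1 ≤ as.length
    · rw [if_pos hl] at hr
      simp only [Sum.inr.injEq, Prod.mk.injEq] at hr
      obtain ⟨rfl, rfl⟩ := hr
      set l := List.zipWith (fun i a => (roundPt g m PY st i, decodeNat a)) (List.range (3 * g + 1)) (as.take (3 * g + 1)) with hl'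
      have hne : l ≠ [] := by
        intro he
        have := congrArg List.length he
        rw [hl', List.length_zipWith, List.length_range, List.length_take, List.length_nil] at this
        omega
      obtain ⟨hmem, -⟩ := argminBy_spec keyW ((0 : ℚ), 0) hne
      obtain ⟨j, hj, hj', hje⟩ := exists_of_mem_zipWith hmem
      rw [List.length_range] at hj
      rw [List.getElem_range] at hje
      obtain ⟨hd, ha⟩ := roundPt_usz g m hPY st (i := j) (by omega)
      have hmemj : (as.take (3 * g + 1))[j] ∈ as := List.mem_of_mem_take (List.getElem_mem hj')
      refine ⟨⟨?_, ?_⟩, rfl, Or.inr ⟨_, hmemj, by rw [hje]⟩, List.drop_suffix _ _⟩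
      · show (argminBy keyW ((0 : ℚ), 0) l).1.den ≤ _
        rw [hje]
        show (roundPt g m PY st j).den ≤ _
        calc (roundPt g m PY st j).den ≤ st.2.1.den * PY * (3 * (g + 1)) := hd
          _ ≤ (3 * (g + 1) * PY) ^ t * PY * (3 * (g + 1)) := by gcongr; exact h.1
          _ = (3 * (g + 1) * PY) ^ (t + 1) := by ring
      · show |(argminBy keyW ((0 : ℚ), 0) l).1| ≤ _
        rw [hje]
        show |roundPt g m PY st j| ≤ _
        calc |roundPt g m PY st j| = |(roundPt g m PY st j - st.2.1) + st.2.1| := by ring_nf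
          _ ≤ |roundPt g m PY st j - st.2.1| + |st.2.1| := abs_add_le _ _
          _ ≤ (g * ((m + 1).factorial : ℚ) + 1) + t * (g * ((m + 1).factorial : ℚ) + 1) := add_le_add ha h.2
          _ = (t + 1 : ℕ) * (g * ((m + 1).factorial : ℚ) + 1) := by push_cast; ring
    · rw [if_neg hl] at hr
      cases hr

/-- **All rounds keep the sizes, on every transcript.** [folklore] -/
theorem iterM_searchRound_usz {g m PY : ℕ} (hPY : 0 < PY) (mk : Maker) (lvl : ℕ) (X : Matrix (Fin (m + 1)) (Fin (m + 1)) ℤ) :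
    ∀ (k t : ℕ) {st : ℕ × ℚ × ℕ} {as as' : List (List Bool)} {st' : ℕ × ℚ × ℕ},
      USz g m PY t st → replay (iterM (searchRound mk g lvl X PY) k st) as = Sum.inr (st', as') →
        USz g m PY (t + k) st' ∧ st'.1 = st.1 + k ∧ (st'.2.2 = st.2.2 ∨ ∃ a ∈ as, st'.2.2 = decodeNat a) ∧ as' <:+ as
  | 0, t, st, as, as', st', h, hr => by
    rw [replay_iterM_zero] at hr
    simp only [Sum.inr.injEq, Prod.mk.injEq] at hr
    obtain ⟨rfl, rfl⟩ := hr
    exact ⟨h, rfl, Or.inl rfl, List.suffix_refl _⟩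
  | k + 1, t, st, as, as', st', h, hr => by
    rw [replay_iterM_succ] at hr
    rcases hro : replay (searchRound mk g lvl X PY st) as with q | ⟨st₁, as₁⟩
    · rw [hro] at hr; cases hr
    · rw [hro] at hr
      dsimp only at hr
      obtain ⟨h1, ht1, hv1, hs1⟩ := searchRound_usz hPY mk lvl X h hro
      obtain ⟨h2, ht2, hv2, hs2⟩ := iterM_searchRound_usz hPY mk lvl X k (t + 1) h1 hr
      refine ⟨by rwa [show t + (k + 1) = t + 1 + k by omega], by omega, ?_, hs2.trans hs1⟩
      rcases hv2 with hv2 | ⟨a, ha, hva⟩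
      · rw [hv2]; rcases hv1 with hv1 | ⟨a, ha, hva⟩
        · exact Or.inl hv1
        · exact Or.inr ⟨a, ha, hva⟩
      · exact Or.inr ⟨a, hs1.subset ha, hva⟩

/-! ### Numeric consequences -/

/-- `3 (g + 1) < 2^{g + 3}`. [folklore] -/
theorem three_mul_succ_lt_two_pow (g : ℕ) : 3 * (g + 1) < 2 ^ (g + 3) := by
  have : g + 1 < 2 ^ (g + 1) := Nat.lt_two_pow_self
  calc 3 * (g + 1) < 4 * 2 ^ (g + 1) := by omega
    _ = 2 ^ (g + 3) := by rw [pow_succ, pow_succ]; ring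

/-- The exponent bounding the denominators: `T (g + 3 + (m+1)²) + 1`. [folklore] -/
def denE (g m T : ℕ) : ℕ := T * (g + 3 + (m + 1) ^ 2) + 1

/-- The exponent bounding the numerators: `T + (g + 1 + (m+1)²) + denE`. [folklore] -/
def numE (g m T : ℕ) : ℕ := T + (g + 1 + (m + 1) ^ 2) + denE g m T

/-- `3 (g+1) P_Y < 2^{g + 3 + (m+1)²}` for `P_Y ≤ (m+1)!`. [folklore] -/
theorem base_lt_two_pow {g m PY : ℕ} (hPY : PY ≤ (m + 1).factorial) : 3 * (g + 1) * PY < 2 ^ (g + 3 + (m + 1) ^ 2) := by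
  rw [pow_add]
  have h1 := three_mul_succ_lt_two_pow g
  have h2 : PY < 2 ^ ((m + 1) ^ 2) := hPY.trans_lt (factorial_succ_lt_two_pow_sq m)
  have h3 : 0 < 2 ^ ((m + 1) ^ 2) := by positivity
  calc 3 * (g + 1) * PY ≤ 3 * (g + 1) * 2 ^ ((m + 1) ^ 2) := Nat.mul_le_mul_left _ h2.le
    _ < 2 ^ (g + 3) * 2 ^ ((m + 1) ^ 2) := Nat.mul_lt_mul_of_pos_right h1 h3

/-- **Denominators are below `2^{denE}`** (`0 < P_Y ≤ (m+1)!`, `t ≤ T`). [folklore] -/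
theorem usz_den_lt {g m PY t T : ℕ} {st : ℕ × ℚ × ℕ} (h : USz g m PY t st) (hPY0 : 0 < PY) (hPY : PY ≤ (m + 1).factorial)
    (ht : t ≤ T) : st.2.1.den < 2 ^ denE g m T := by
  have hb := base_lt_two_pow (g := g) hPY
  have hb1 : 1 ≤ 3 * (g + 1) * PY := Nat.one_le_iff_ne_zero.2 (by positivity)
  have hle : st.2.1.den ≤ 2 ^ (T * (g + 3 + (m + 1) ^ 2)) :=
    calc st.2.1.den ≤ (3 * (g + 1) * PY) ^ t := h.1
      _ ≤ (3 * (g + 1) * PY) ^ T := Nat.pow_le_pow_right hb1 ht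
      _ ≤ (2 ^ (g + 3 + (m + 1) ^ 2)) ^ T := Nat.pow_le_pow_left hb.le _
      _ = 2 ^ (T * (g + 3 + (m + 1) ^ 2)) := by rw [← pow_mul, mul_comm]
  unfold denE
  rw [pow_succ]
  have : 1 ≤ 2 ^ (T * (g + 3 + (m + 1) ^ 2)) := Nat.one_le_two_pow
  omega

/-- `g (m+1)! + 1 < 2^{g + 1 + (m+1)²}`. [folklore] -/
theorem gfact_lt_two_pow (g m : ℕ) : g * (m + 1).factorial + 1 < 2 ^ (g + 1 + (m + 1) ^ 2) := by
  rw [pow_add]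
  have h1 : g + 1 < 2 ^ (g + 1) := Nat.lt_two_pow_self
  have h2 : (m + 1).factorial < 2 ^ ((m + 1) ^ 2) := factorial_succ_lt_two_pow_sq m
  have h3 : 1 ≤ (m + 1).factorial := Nat.one_le_iff_ne_zero.2 (Nat.factorial_ne_zero _)
  calc g * (m + 1).factorial + 1 ≤ (g + 1) * (m + 1).factorial := by nlinarith
    _ < 2 ^ (g + 1) * 2 ^ ((m + 1) ^ 2) := Nat.mul_lt_mul'' h1 h2

/-- **Numerators are below `2^{numE}`** in absolute value (`0 < P_Y ≤ (m+1)!`, `t ≤ T`). [folklore] -/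
theorem usz_num_lt {g m PY t T : ℕ} {st : ℕ × ℚ × ℕ} (h : USz g m PY t st) (hPY0 : 0 < PY) (hPY : PY ≤ (m + 1).factorial)
    (ht : t ≤ T) : st.2.1.num.natAbs < 2 ^ numE g m T := by
  have hden := usz_den_lt h hPY0 hPY ht
  set r := st.2.1 with hr
  -- `|num| = |r| · den ≤ t (g (m+1)! + 1) · den`
  have hq : (r.num.natAbs : ℚ) ≤ (t * (g * (m + 1).factorial + 1) * r.den : ℕ) := by
    have e : (r.num : ℚ) = r * r.den := (Rat.mul_den_eq_num r).symm
    have : (r.num.natAbs : ℚ) = |r| * r.den := by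
      rw [Nat.cast_natAbs, Int.cast_abs, e, abs_mul, Nat.abs_cast]
    rw [this]
    push_cast
    have hd : (0 : ℚ) ≤ r.den := by positivity
    have := mul_le_mul_of_nonneg_right h.2 hd
    simpa [hr] using this
  have hnat : r.num.natAbs ≤ t * (g * (m + 1).factorial + 1) * r.den := by exact_mod_cast hq
  have h1 : t < 2 ^ T := lt_of_le_of_lt ht Nat.lt_two_pow_self
  have h2 := gfact_lt_two_pow g m
  calc r.num.natAbs ≤ t * (g * (m + 1).factorial + 1) * r.den := hnat
    _ < 2 ^ T * 2 ^ (g + 1 + (m + 1) ^ 2) * 2 ^ denE g m T := by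
        have hpos : 0 < 2 ^ T * 2 ^ (g + 1 + (m + 1) ^ 2) := by positivity
        calc t * (g * (m + 1).factorial + 1) * r.den ≤ (2 ^ T * 2 ^ (g + 1 + (m + 1) ^ 2)) * r.den :=
              Nat.mul_le_mul_right _ (Nat.mul_le_mul h1.le h2.le)
          _ < (2 ^ T * 2 ^ (g + 1 + (m + 1) ^ 2)) * 2 ^ denE g m T := Nat.mul_lt_mul_of_pos_left hden hpos
    _ = 2 ^ numE g m T := by rw [numE]; ring

/-- The exponent bounding the entries of the scaled query matrices at any grid point of a state
satisfying the invariant: `(denE at T+1) + 2 + (T + 1) + (g + 1 + (m+1)²)`. [folklore] -/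
def entE (g m T : ℕ) : ℕ := denE g m (T + 1) + (T + 1 + (g + 1 + (m + 1) ^ 2) + 2)

/-- **Entries of the query matrix at a grid point are below `2^{entE}`**: for a `0/1` matrix `X`, a state
satisfying the invariant at `t ≤ T` and a grid index `i ≤ 3g`, every entry of
`scaledMatrix X (roundPt g m P_Y st i)` has absolute value `< 2^{entE g m T}`. [cite: AaronsonArkhipovToC2013, proof of Thm. 4.3, eq. (4.3) (p. 176)] -/
theorem roundPt_entry_lt {g m PY t T : ℕ} {X : Matrix (Fin (m + 1)) (Fin (m + 1)) ℤ} (hX : IsZeroOne X)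
    {st : ℕ × ℚ × ℕ} (h : USz g m PY t st) (hPY0 : 0 < PY) (hPY : PY ≤ (m + 1).factorial) (ht : t ≤ T)
    {i : ℕ} (hi : i ≤ 3 * g) (a b : Fin (m + 1)) :
    (scaledMatrix X (roundPt g m PY st i) a b).natAbs < 2 ^ entE g m T := by
  set pt := roundPt g m PY st i with hpt
  obtain ⟨hd, hdist⟩ := roundPt_usz g m hPY0 st hi
  -- the point is a state of the invariant at `t + 1`
  have hst : USz g m PY (t + 1) (st.1, pt, 0) := by
    refine ⟨?_, ?_⟩
    · show pt.den ≤ _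
      calc pt.den ≤ st.2.1.den * PY * (3 * (g + 1)) := hd
        _ ≤ (3 * (g + 1) * PY) ^ t * PY * (3 * (g + 1)) := by gcongr; exact h.1
        _ = (3 * (g + 1) * PY) ^ (t + 1) := by ring
    · show |pt| ≤ _
      calc |pt| = |(pt - st.2.1) + st.2.1| := by ring_nf
        _ ≤ |pt - st.2.1| + |st.2.1| := abs_add_le _ _
        _ ≤ (g * ((m + 1).factorial : ℚ) + 1) + t * (g * ((m + 1).factorial : ℚ) + 1) := add_le_add hdist h.2
        _ = (t + 1 : ℕ) * (g * ((m + 1).factorial : ℚ) + 1) := by push_cast; ring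
  have hden : pt.den < 2 ^ denE g m (T + 1) := usz_den_lt hst hPY0 hPY (by omega)
  have habs : |pt| ≤ (t + 1 : ℕ) * (g * ((m + 1).factorial : ℚ) + 1) := hst.2
  have hent := abs_scaledMatrix_le hX pt a b
  -- `2 + |pt| < 2^{T+1} · 2^{g+1+(m+1)²} · 4`
  have h2 : (2 : ℚ) + |pt| < (2 ^ (T + 1 + (g + 1 + (m + 1) ^ 2) + 2) : ℕ) := by
    have ht1 : ((t + 1 : ℕ) : ℚ) ≤ (2 ^ (T + 1) : ℕ) := by
      exact_mod_cast (lt_of_le_of_lt (by omega : t + 1 ≤ T + 1) Nat.lt_two_pow_self).le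
    have hg1 : g * ((m + 1).factorial : ℚ) + 1 ≤ (2 ^ (g + 1 + (m + 1) ^ 2) : ℕ) := by
      exact_mod_cast (gfact_lt_two_pow g m).le
    have hprod : |pt| ≤ (2 ^ (T + 1) : ℕ) * (2 ^ (g + 1 + (m + 1) ^ 2) : ℕ) :=
      habs.trans (mul_le_mul ht1 hg1 (by positivity) (by positivity))
    have e4 : ((2 ^ (T + 1 + (g + 1 + (m + 1) ^ 2) + 2) : ℕ) : ℚ) = ((2 ^ (T + 1) : ℕ) : ℚ) * ((2 ^ (g + 1 + (m + 1) ^ 2) : ℕ) : ℚ) * 4 := by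
      push_cast; rw [pow_add, pow_add]; norm_num
    rw [e4]
    have h4 : (1 : ℚ) ≤ ((2 ^ (T + 1) : ℕ) : ℚ) * ((2 ^ (g + 1 + (m + 1) ^ 2) : ℕ) : ℚ) := by
      have a1 : (1 : ℚ) ≤ ((2 ^ (T + 1) : ℕ) : ℚ) := by exact_mod_cast Nat.one_le_two_pow
      have a2 : (1 : ℚ) ≤ ((2 ^ (g + 1 + (m + 1) ^ 2) : ℕ) : ℚ) := by exact_mod_cast Nat.one_le_two_pow
      nlinarith
    nlinarith
  have hfin : ((scaledMatrix X pt a b).natAbs : ℚ) < (2 ^ entE g m T : ℕ) := by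
    rw [Nat.cast_natAbs, Int.cast_abs]
    calc |((scaledMatrix X pt a b : ℤ) : ℚ)| ≤ pt.den * (2 + |pt|) := hent
      _ < (2 ^ denE g m (T + 1) : ℕ) * (2 ^ (T + 1 + (g + 1 + (m + 1) ^ 2) + 2) : ℕ) := by
          have hdq : (pt.den : ℚ) < (2 ^ denE g m (T + 1) : ℕ) := by exact_mod_cast hden
          exact mul_lt_mul'' hdq h2 (by positivity) (by positivity)
      _ = (2 ^ entE g m T : ℕ) := by rw [entE, pow_add]; push_cast; ring
  exact_mod_cast hfin

/-! ### The round count for every `g` -/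

/-- **`rounds g m ≤ RB g m` for every `g`** (the tree's `rounds_le_RB` assumes `g ≥ 1`; for `g = 0`,
`rounds 0 m = 1`). [cite: AaronsonArkhipovToC2013, proof of Thm. 4.3, eqs. (4.16)–(4.18) (p. 177)] -/
theorem rounds_le_RB' (g m : ℕ) : rounds g m ≤ RB g m := by
  rcases Nat.eq_zero_or_pos g with rfl | hg
  · simp [rounds, RB]
  · exact rounds_le_RB hg m

end PerSearch

end Literature.Computability.QuantumComplexity
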